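import Summits.QuantumAdvantage.QuantumAdvantage.Theorems.MobiusLadderDigitPolyUniformityStubEnds
import HarnessLib

/-!
# Crux `MobiusLadder.LiouvilleOrthogonalTC0` (stmt-QuantumAdvantage-1393), line `Sketch`,
# skeleton v9.1: stub `stub_ends_sqrt` (the two-ends rung at `k + m ≤ c √n`)

There is an absolute `c > 0` such that for every `ε > 0`, eventually in `n`: for all depths
`k, m` with `k + m ≤ c √n` and every `1`-bounded `g : ℕ → ℕ → ℝ`,
`|Σ_{N < 2^n} λ(N) g(N mod 2^k, ⌊N / 2^{n−m}⌋)| ≤ ε 2^n`.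

This is the sibling crux's `DigitPolyUniformity.Sketch.stub_ends` (hypothesis `(k + m)^3 ≤ n`)
pushed to the natural range `k + m ≤ c √n` of Green's character-sum bound to `2`-power moduli
(moduli `2^k ≤ e^{(c₂/8)√(n log 2)}`); the proof is the same and only the numerics change.

## Proof

* Regroup `Σ_{N<2^n}` by the `2^{k+m}` atoms `{N < 2^n : N ≡ a (2^k), ⌊N/2^{n−m}⌋ = j}`
  (`StubEnds.abs_sum_mul_ends_le`), each of which is a progression mod `2^k` inside an interval
  `[j 2^{n−m}, (j+1) 2^{n−m})`, so that its `λ`-sum is a difference of two initial progression sums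
  `Σ_{N < X, N ≡ a (2^k)} λ(N)`, `X ≤ 2^n` (`StubEnds.sum_atom_eq`).
* THE INPUT: Green's PROVED prime number theorem for `λ` twisted by characters to `2`-power
  moduli, `green_liouville_character_twoPower_holds` (constants `c₂, K`), made uniform in
  `X ≤ 2^n`, `t ≤ k` by `GreenWalsh.char_bound_uniform` and transported to every progression
  class mod `2^k` by `GreenWalsh.norm_sum_progression_le`: every `|Σ_{N < X, N ≡ a (2^k)} λ(N)|`,
  `X ≤ 2^n`, is at most `K 2^n e^{−(c₂/2)√(n log 2)}` as soon as `n log 2 ≥ max(1, c₂²)` and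
  `2^k ≤ e^{(c₂/8)√(n log 2)}`.
* Numerics, with `c := min 1 (c₂ √(log 2) / (8 log 2))`, so that `c log 2 ≤ (c₂/8) √(log 2)`:
  from `k + m ≤ c √n` one gets `(k + m) log 2 ≤ (c₂/8) √(log 2) √n`, whence the admissibility
  `2^k ≤ e^{(c₂/8)√(n log 2)}`, and the final loss
  `2^{k+m+1} K e^{−(c₂/2)√(n log 2)} ≤ ε` as soon as
  `log 2 + log K − log ε ≤ (3c₂/8) √(log 2) √n`; also `c ≤ 1` gives `k + m ≤ √n ≤ n`.
-/

set_option linter.dupNamespace false -- D-0017: single-problem summit ⇒ QuantumAdvantage.QuantumAdvantage by design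

noncomputable section

namespace Summit.QuantumAdvantage.QuantumAdvantage.Theorems.LiouvilleOrthogonalTC0

open Filter Finset ArithmeticFunction
open Literature.NumberTheory.LFunctions
open Summit.QuantumAdvantage.DigitPolyUniformity.Sketch.StubEnds

/-- **Stub `stub_ends_sqrt` (ends equidistribution of `λ` up to total depth `c √n`).** There is an
absolute `c > 0` such that for every `ε > 0`, eventually in `n`: for all depths `k, m` with
`k + m ≤ c √n` and every `1`-bounded `g`, `|Σ_{N<2^n} λ(N) g(N mod 2^k, ⌊N/2^{n−m}⌋)| ≤ ε 2^n`.
The `2^{k+m}` atoms "progression mod `2^k` ∩ interval of length `2^{n−m}`" each carry a `λ`-sum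
`≤ 2 K 2^n e^{−(c₂/2)√(n log 2)}` by the prime number theorem for `λ` twisted by characters to
`2`-power moduli (Green 2012, Theorem 3, with the §1 remark on the Liouville function), PROVED in
the tree as `green_liouville_character_twoPower_holds` and transported to progressions by
`GreenWalsh.char_bound_uniform` / `GreenWalsh.norm_sum_progression_le`; with
`c = min 1 (c₂ √(log 2) / (8 log 2))` the modulus `2^k` is admissible and
`2^{k+m+1} K e^{−(c₂/2)√(n log 2)} ≤ ε` eventually.
[cite: Green2012, Theorem 3 and §1 (remark on the Liouville function)] -/
theorem stub_ends_sqrt : ∃ c : ℝ, 0 < c ∧ ∀ ε : ℝ, 0 < ε → ∀ᶠ n : ℕ in atTop, ∀ k m : ℕ,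
    ((k : ℝ) + m) ≤ c * Real.sqrt n →
      ∀ g : ℕ → ℕ → ℝ, (∀ a j, |g a j| ≤ 1) →
        |∑ N ∈ Finset.range (2 ^ n),
            (ArithmeticFunction.liouville N : ℝ) * g (N % 2 ^ k) (N / 2 ^ (n - m))| ≤
          ε * 2 ^ n := by
  obtain ⟨c, hc, K, hK⟩ := green_liouville_character_twoPower_holds
  have hlog2 : 0 < Real.log 2 := Real.log_pos one_lt_two
  have hsl2 : 0 < Real.sqrt (Real.log 2) := Real.sqrt_pos.2 hlog2
  -- the absolute constant `c₀ = min 1 (c √(log 2) / (8 log 2))`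
  obtain ⟨c₀, hc₀0, hc₀1, hc₀2⟩ : ∃ c₀ : ℝ, 0 < c₀ ∧ c₀ ≤ 1 ∧
      c₀ * Real.log 2 ≤ c / 8 * Real.sqrt (Real.log 2) := by
    refine ⟨min 1 (c * Real.sqrt (Real.log 2) / (8 * Real.log 2)),
      lt_min one_pos (div_pos (mul_pos hc hsl2) (mul_pos (by norm_num) hlog2)),
      min_le_left _ _, ?_⟩
    calc min 1 (c * Real.sqrt (Real.log 2) / (8 * Real.log 2)) * Real.log 2
        ≤ c * Real.sqrt (Real.log 2) / (8 * Real.log 2) * Real.log 2 :=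
          mul_le_mul_of_nonneg_right (min_le_right _ _) hlog2.le
      _ = c / 8 * Real.sqrt (Real.log 2) := by
          field_simp
  refine ⟨c₀, hc₀0, ?_⟩
  intro ε hε
  -- enlarge the constant to `K' ≥ 1`
  set K' : ℝ := max K 1 with hK'def
  have hK'1 : 1 ≤ K' := le_max_right _ _
  have hK'0 : 0 < K' := lt_of_lt_of_le one_pos hK'1
  have hK' : ∀ t N : ℕ, ∀ χ : DirichletCharacter ℂ (2 ^ t),
      ((2 : ℝ) ^ t ≤ Real.exp (c * Real.sqrt (Real.log N))) →
        ‖∑ x ∈ range N, ((liouville x : ℤ) : ℂ) * χ (x : ZMod (2 ^ t))‖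
          ≤ K' * (N : ℝ) * Real.exp (-(c * Real.sqrt (Real.log N))) := by
    intro t N χ h
    refine (hK t N χ h).trans ?_
    gcongr
    exact le_max_left _ _
  -- the two eventualities
  have E1 : ∀ᶠ n : ℕ in atTop, max 1 (c ^ 2) ≤ Real.log ((2 : ℝ) ^ n) := by
    refine (Filter.eventually_ge_atTop ⌈max 1 (c ^ 2) / Real.log 2⌉₊).mono fun n hn => ?_
    rw [Real.log_pow]
    have h := Nat.ceil_le.1 hn
    rw [div_le_iff₀ hlog2] at h
    linarith
  have E3 := eventually_linear_le_sqrt hlog2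
    (le_max_left 0 (Real.log 2 + Real.log K' - Real.log ε))
    (mul_pos (div_pos (mul_pos three_pos hc) (by norm_num : (0 : ℝ) < 8)) hsl2)
  filter_upwards [E1, E3] with n h1 h3 k m hkm g hg
  -- bookkeeping: `k + m ≤ √n ≤ n`
  have hkm1 : ((k : ℝ) + m) ≤ Real.sqrt n :=
    hkm.trans (mul_le_of_le_one_left (Real.sqrt_nonneg _) hc₀1)
  have hs : k + m ≤ n := by
    have hsq : (((k + m : ℕ) : ℝ)) ^ 2 ≤ n := by
      push_cast
      calc ((k : ℝ) + m) ^ 2 ≤ (Real.sqrt n) ^ 2 := pow_le_pow_left₀ (by positivity) hkm1 2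
        _ = n := Real.sq_sqrt (Nat.cast_nonneg n)
    have hsq' : (k + m) ^ 2 ≤ n := by exact_mod_cast hsq
    exact le_trans (Nat.le_self_pow two_ne_zero _) hsq'
  have hm : m ≤ n := le_trans (Nat.le_add_left m k) hs
  have hcast : ((2 ^ n : ℕ) : ℝ) = (2 : ℝ) ^ n := by push_cast; ring
  have hsqrt : Real.sqrt (Real.log ((2 : ℝ) ^ n)) = Real.sqrt n * Real.sqrt (Real.log 2) := by
    rw [Real.log_pow, Real.sqrt_mul (Nat.cast_nonneg n)]
  -- the linear numerics: `(k + m) log 2 ≤ (c/8) √(log 2) √n` and the constant loss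
  have hlin : Real.log 2 * ((k : ℝ) + m) ≤ c / 8 * Real.sqrt (Real.log 2) * Real.sqrt n := by
    calc Real.log 2 * ((k : ℝ) + m) ≤ Real.log 2 * (c₀ * Real.sqrt n) :=
          mul_le_mul_of_nonneg_left hkm hlog2.le
      _ = c₀ * Real.log 2 * Real.sqrt n := by ring
      _ ≤ c / 8 * Real.sqrt (Real.log 2) * Real.sqrt n :=
          mul_le_mul_of_nonneg_right hc₀2 (Real.sqrt_nonneg _)
  have h3' := h3 0 (by norm_num)
  have hmax : Real.log 2 + Real.log K' - Real.log ε ≤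
      max 0 (Real.log 2 + Real.log K' - Real.log ε) := le_max_right _ _
  push_cast at h3'
  rw [mul_zero, zero_add] at h3'
  -- the hypotheses of the uniform character-sum bound at `N = 2^n`, `t₀ = k`
  have hL : max 1 (c ^ 2) ≤ Real.log ((2 ^ n : ℕ) : ℝ) := by rw [hcast]; exact h1
  have hk2 : (2 : ℝ) ^ k ≤ Real.exp (c / 8 * Real.sqrt (Real.log ((2 ^ n : ℕ) : ℝ))) := by
    rw [hcast, hsqrt]
    have hk : (k : ℝ) ≤ k + m := by
      have : (0 : ℝ) ≤ m := Nat.cast_nonneg m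
      linarith
    have hk' : Real.log 2 * k ≤ Real.log 2 * (k + m) := mul_le_mul_of_nonneg_left hk hlog2.le
    calc (2 : ℝ) ^ k = Real.exp (Real.log ((2 : ℝ) ^ k)) := (Real.exp_log (by positivity)).symm
      _ = Real.exp (k * Real.log 2) := by rw [Real.log_pow]
      _ ≤ Real.exp (c / 8 * (Real.sqrt n * Real.sqrt (Real.log 2))) := by
          refine Real.exp_le_exp.2 ?_
          nlinarith [hk', hlin]
  have hchar := GreenWalsh.char_bound_uniform hc hK'1 hK' (N := 2 ^ n) (t₀ := k) hL hk2
  have hprog := GreenWalsh.norm_sum_progression_le hchar k le_rfl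
  -- the progression sums in real form
  have hP : ∀ X : ℕ, X ≤ 2 ^ n → ∀ a : ℕ, a < 2 ^ k →
      |∑ N ∈ (range X).filter (fun N => N % 2 ^ k = a), (liouville N : ℝ)| ≤
        K' * ((2 ^ n : ℕ) : ℝ) *
          Real.exp (-(c / 2 * Real.sqrt (Real.log ((2 ^ n : ℕ) : ℝ)))) := by
    intro X hX a ha
    rw [abs_sum_filter_mod_eq_norm k a X ha]
    exact hprog X hX _
  -- the atoms
  have hatom : ∀ a : ℕ, a < 2 ^ k → ∀ j : ℕ, j < 2 ^ m →
      |∑ N ∈ (range (2 ^ n)).filter (fun N => (N % 2 ^ k, N / 2 ^ (n - m)) = (a, j)),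
          (liouville N : ℝ)| ≤
        2 * (K' * ((2 ^ n : ℕ) : ℝ) *
          Real.exp (-(c / 2 * Real.sqrt (Real.log ((2 ^ n : ℕ) : ℝ))))) := by
    intro a ha j hj
    have hLn : 2 ^ m * 2 ^ (n - m) = 2 ^ n := by rw [← pow_add, Nat.add_sub_cancel' hm]
    have hX1 : (j + 1) * 2 ^ (n - m) ≤ 2 ^ n := by
      calc (j + 1) * 2 ^ (n - m) ≤ 2 ^ m * 2 ^ (n - m) := Nat.mul_le_mul_right _ hj
        _ = 2 ^ n := hLn
    have hX0 : j * 2 ^ (n - m) ≤ 2 ^ n :=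
      le_trans (Nat.mul_le_mul_right _ (Nat.le_succ j)) hX1
    rw [sum_atom_eq n k m a j hm hj]
    refine (abs_sub _ _).trans ?_
    have hA := hP _ hX1 a ha
    have hB := hP _ hX0 a ha
    linarith
  -- assembly
  have hE : (2 : ℝ) ^ k * (2 : ℝ) ^ m * 2 * K' *
      Real.exp (-(c / 2 * Real.sqrt (Real.log ((2 : ℝ) ^ n)))) ≤ ε := by
    rw [hsqrt]
    have hpow : (2 : ℝ) ^ k * (2 : ℝ) ^ m * 2 =
        Real.exp (((k + m + 1 : ℕ) : ℝ) * Real.log 2) := by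
      rw [← Real.log_pow, Real.exp_log (by positivity)]
      ring
    rw [hpow, ← Real.exp_log hK'0, ← Real.exp_add, ← Real.exp_add]
    calc _ ≤ Real.exp (Real.log ε) := by
          refine Real.exp_le_exp.2 ?_
          push_cast
          nlinarith [h3', hmax, hlin]
      _ = ε := Real.exp_log hε
  calc |∑ N ∈ range (2 ^ n), (liouville N : ℝ) * g (N % 2 ^ k) (N / 2 ^ (n - m))|
      ≤ ∑ a ∈ range (2 ^ k), ∑ j ∈ range (2 ^ m),
          |∑ N ∈ (range (2 ^ n)).filter (fun N => (N % 2 ^ k, N / 2 ^ (n - m)) = (a, j)),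
            (liouville N : ℝ)| := abs_sum_mul_ends_le n k m hm _ g hg
    _ ≤ ∑ a ∈ range (2 ^ k), ∑ j ∈ range (2 ^ m),
          2 * (K' * ((2 ^ n : ℕ) : ℝ) *
            Real.exp (-(c / 2 * Real.sqrt (Real.log ((2 ^ n : ℕ) : ℝ))))) :=
        sum_le_sum fun a ha => sum_le_sum fun j hj => hatom a (mem_range.1 ha) j (mem_range.1 hj)
    _ = ((2 : ℝ) ^ k * (2 : ℝ) ^ m * 2 * K' *
          Real.exp (-(c / 2 * Real.sqrt (Real.log ((2 : ℝ) ^ n))))) * (2 : ℝ) ^ n := by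
        rw [sum_const, sum_const, card_range, card_range, nsmul_eq_mul, nsmul_eq_mul]
        push_cast
        ring
    _ ≤ ε * (2 : ℝ) ^ n := mul_le_mul_of_nonneg_right hE (by positivity)

end Summit.QuantumAdvantage.QuantumAdvantage.Theorems.LiouvilleOrthogonalTC0

end
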